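import Mathlib
import HarnessLib

/-!
# Proximity of an explicit Ritz subspace to the true spectral subspace (Kato–Temple / Davis–Kahan, elementary form)

Topic `Literature/Analysis/OperatorTheory`; proofs-layer file (theorems only, no definitions, no named facts).

The coercivity step `SpectralCutCoercivity.coercive_of_cut_of_proj_near` consumes ONE inequality relating the orthogonal
projection `P_W` onto the (unknown) true low spectral subspace `W` of a self-adjoint operator and the projection `P_V`
onto an EXPLICIT Ritz space `V`:  `‖P_W u‖ ≤ ‖P_V u‖ + θ ‖u‖`.  This file derives that inequality from certifiable data,
with every spectral-theorem input isolated as a hypothesis on bounded operators (apply to `B = (H + c)⁻¹`):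

* `norm_proj_le_residual_div_gap` — single-vector exclusion (Kato–Temple mechanism) [cite: Kato1949, Lemma 2 / (15)]:
  if `Q` is a self-adjoint idempotent commuting with `B`, `Re ⟪B ξ, ξ⟫ ≤ bhi ‖ξ‖²` on `ran Q`, and `‖B v − m v‖ ≤ ρ` with
  `m > bhi`, then `‖Q v‖ ≤ ρ / (m − bhi)`;
* `norm_proj_sum_le_sqrt` — for an orthonormal family `v` with `‖Q (v k)‖ ≤ t k`:
  `‖Q (∑ c k • v k)‖ ≤ √(∑ (t k)²) · ‖∑ c k • v k‖` (the Frobenius form of the one-sided `sin Θ` bound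
  [cite: DavisKahan1970, §2 sin Θ theorem]);
* `norm_sub_proj_le_of_fixed` — transfer to the other side: if `w = P_W v` and `‖v − P_W v‖ ≤ θ₁ ‖v‖` then
  `‖w − P_V w‖ ≤ θ₁ ‖w‖` whenever `v ∈ ran P_V` (best approximation + an explicit multiple of `v`);
* `norm_projW_comp_coproj_le` — `‖P_W (u − P_V u)‖ ≤ θ₂ ‖u‖` from `‖w − P_V w‖ ≤ θ₂ ‖w‖` on `ran P_W`;
* `norm_projW_le_projV_add` — the consumable form `‖P_W u‖ ≤ ‖P_V u‖ + θ₂ ‖u‖`.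

Equality of dimensions (`dim V = dim W = n`, from an exact certified eigenvalue count) is what makes every
`w ∈ W` of the form `P_W v`, `v ∈ V` (`surjective_of_proj_injective`: injective + equal `finrank` ⇒ surjective).
Everything is proved; nothing about any particular operator is asserted.

## References

* T. Kato, *On the upper and lower bounds of eigenvalues*, J. Phys. Soc. Japan 4 (1949) 334–339. [Kato1949]
* C. Davis, W. M. Kahan, *The rotation of eigenvectors by a perturbation. III*, SIAM J. Numer. Anal. 7 (1970) 1–46. [DavisKahan1970]
* G. H. Golub, C. F. Van Loan, *Matrix Computations*, 4th ed., JHU Press 2013, Thm 8.1.10 / Cor 8.1.11. [GolubVanLoan2013]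
-/

noncomputable section

open scoped InnerProductSpace
open RCLike

namespace Literature.Analysis.OperatorTheory

variable {𝕜 : Type*} [RCLike 𝕜] {E : Type*} [NormedAddCommGroup E] [InnerProductSpace 𝕜 E]

/-- For a self-adjoint idempotent `P`: `Re ⟪P x, x⟫ = ‖P x‖²`. [folklore] -/
theorem re_inner_proj_self (P : E →L[𝕜] E) (hsa : ∀ x y : E, ⟪P x, y⟫_𝕜 = ⟪x, P y⟫_𝕜)
    (hid : ∀ x : E, P (P x) = P x) (x : E) : re ⟪P x, x⟫_𝕜 = ‖P x‖ ^ 2 := by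
  have h : ⟪P x, x⟫_𝕜 = ⟪P x, P x⟫_𝕜 := by
    conv_lhs => rw [← hid x]
    rw [hsa (P x) x]
  rw [h, inner_self_eq_norm_sq_to_K]; norm_cast

/-- Pythagoras for a self-adjoint idempotent: `‖x‖² = ‖P x‖² + ‖x − P x‖²`. [folklore] -/
theorem norm_sq_eq_proj_add_coproj (P : E →L[𝕜] E) (hsa : ∀ x y : E, ⟪P x, y⟫_𝕜 = ⟪x, P y⟫_𝕜)
    (hid : ∀ x : E, P (P x) = P x) (x : E) : ‖x‖ ^ 2 = ‖P x‖ ^ 2 + ‖x - P x‖ ^ 2 := by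
  have h1 : ‖x - P x‖ ^ 2 = ‖x‖ ^ 2 - 2 * re ⟪x, P x⟫_𝕜 + ‖P x‖ ^ 2 := norm_sub_sq x (P x)
  have h2 : re ⟪x, P x⟫_𝕜 = ‖P x‖ ^ 2 := by
    rw [← hsa x x]; exact re_inner_proj_self P hsa hid x
  rw [h1, h2]; ring

/-- `‖P x‖ ≤ ‖x‖` and `‖x − P x‖ ≤ ‖x‖` for a self-adjoint idempotent. [folklore] -/
theorem norm_proj_le (P : E →L[𝕜] E) (hsa : ∀ x y : E, ⟪P x, y⟫_𝕜 = ⟪x, P y⟫_𝕜)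
    (hid : ∀ x : E, P (P x) = P x) (x : E) : ‖P x‖ ≤ ‖x‖ ∧ ‖x - P x‖ ≤ ‖x‖ := by
  have h := norm_sq_eq_proj_add_coproj P hsa hid x
  constructor
  · nlinarith [norm_nonneg (P x), norm_nonneg x, norm_nonneg (x - P x)]
  · nlinarith [norm_nonneg (P x), norm_nonneg x, norm_nonneg (x - P x)]

/-- **Single-vector exclusion (Kato–Temple mechanism)** [cite: Kato1949, Lemma 2]. `Q` a self-adjoint idempotent
commuting with the bounded self-adjoint `B`, `B ≤ bhi` on `ran Q` (as a real quadratic form), and an approximate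
eigenpair `‖B v − m v‖ ≤ ρ` with `m > bhi`: then `‖Q v‖ ≤ ρ / (m − bhi)`. (For `B = (H + c)⁻¹`, `Q = 1 − P_W` with
`W` the spectral subspace of `H` below a cut, this bounds how far a Ritz vector sticks out of `W`.) -/
theorem norm_proj_le_residual_div_gap (B Q : E →L[𝕜] E)
    (hQB : ∀ x : E, Q (B x) = B (Q x))
    (hsa : ∀ x y : E, ⟪Q x, y⟫_𝕜 = ⟪x, Q y⟫_𝕜) (hid : ∀ x : E, Q (Q x) = Q x)
    {bhi m ρ : ℝ} (hhi : ∀ x : E, re ⟪B (Q x), Q x⟫_𝕜 ≤ bhi * ‖Q x‖ ^ 2)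
    (hgap : bhi < m) (v : E) (hres : ‖B v - (m : 𝕜) • v‖ ≤ ρ) :
    ‖Q v‖ ≤ ρ / (m - bhi) := by
  have hgap' : 0 < m - bhi := by linarith
  -- Re ⟪B (Q v), Q v⟫ = m ‖Q v‖² + Re ⟪Q r, Q v⟫ with r = B v − m v
  set r : E := B v - (m : 𝕜) • v with hr
  have hBv : B v = (m : 𝕜) • v + r := by rw [hr]; abel
  have hdecomp : re ⟪B (Q v), Q v⟫_𝕜 = m * ‖Q v‖ ^ 2 + re ⟪Q r, Q v⟫_𝕜 := by
    rw [← hQB v, hBv, map_add, map_smul, inner_add_left, inner_smul_left, map_add]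
    congr 1
    rw [RCLike.conj_ofReal, re_ofReal_mul, inner_self_eq_norm_sq_to_K]
    norm_cast
  have hQr : ‖Q r‖ ≤ ρ := le_trans (norm_proj_le Q hsa hid r).1 hres
  have hcs : re ⟪Q r, Q v⟫_𝕜 ≥ -(ρ * ‖Q v‖) := by
    have h1 : |re ⟪Q r, Q v⟫_𝕜| ≤ ‖Q r‖ * ‖Q v‖ :=
      le_trans (RCLike.abs_re_le_norm _) (norm_inner_le_norm _ _)
    have h2 : ‖Q r‖ * ‖Q v‖ ≤ ρ * ‖Q v‖ := mul_le_mul_of_nonneg_right hQr (norm_nonneg _)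
    have := neg_abs_le (re ⟪Q r, Q v⟫_𝕜)
    linarith
  have hmain : (m - bhi) * ‖Q v‖ ^ 2 ≤ ρ * ‖Q v‖ := by
    have := hhi v
    nlinarith [hdecomp, hcs, this]
  have hQv : 0 ≤ ‖Q v‖ := norm_nonneg _
  rw [le_div_iff₀ hgap']
  by_cases h0 : ‖Q v‖ = 0
  · rw [h0]; simp only [zero_mul]
    have : 0 ≤ ρ := le_trans (norm_nonneg _) hQr
    linarith
  · have hpos : 0 < ‖Q v‖ := lt_of_le_of_ne hQv (Ne.symm h0)
    have : (m - bhi) * ‖Q v‖ * ‖Q v‖ ≤ ρ * ‖Q v‖ := by nlinarith [hmain]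
    have := le_of_mul_le_mul_right this hpos
    linarith

/-- **Frobenius form of the one-sided `sin Θ` bound** [cite: DavisKahan1970, §2]. For an orthonormal family `v`
with `‖Q (v k)‖ ≤ t k`: `‖Q (∑ c k • v k)‖ ≤ √(∑ (t k)²) ‖∑ c k • v k‖`. -/
theorem norm_proj_sum_le_sqrt {ι : Type*} [Fintype ι] (Q : E →L[𝕜] E) (v : ι → E) (hv : Orthonormal 𝕜 v)
    (t : ι → ℝ) (ht : ∀ k, ‖Q (v k)‖ ≤ t k) (c : ι → 𝕜) :
    ‖Q (∑ k, c k • v k)‖ ≤ Real.sqrt (∑ k, t k ^ 2) * ‖∑ k, c k • v k‖ := by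
  have hnorm : ‖∑ k, c k • v k‖ ^ 2 = ∑ k, ‖c k‖ ^ 2 := by
    have h := hv.inner_sum c c Finset.univ
    have h2 : (‖∑ k, c k • v k‖ ^ 2 : ℝ) = re ⟪∑ k, c k • v k, ∑ k, c k • v k⟫_𝕜 := by
      rw [inner_self_eq_norm_sq_to_K]; norm_cast
    rw [h2, h, map_sum]
    congr 1; ext k
    rw [RCLike.conj_mul, show ((‖c k‖ : 𝕜) ^ 2) = ((‖c k‖ ^ 2 : ℝ) : 𝕜) by push_cast; ring, ofReal_re]
  have ht0 : ∀ k, 0 ≤ t k := fun k => le_trans (norm_nonneg _) (ht k)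
  have h1 : ‖Q (∑ k, c k • v k)‖ ≤ ∑ k, ‖c k‖ * t k := by
    rw [map_sum]
    refine le_trans (norm_sum_le _ _) (Finset.sum_le_sum fun k _ => ?_)
    rw [map_smul, norm_smul]
    exact mul_le_mul_of_nonneg_left (ht k) (norm_nonneg _)
  have h2 : (∑ k, ‖c k‖ * t k) ^ 2 ≤ (∑ k, ‖c k‖ ^ 2) * ∑ k, t k ^ 2 :=
    Finset.sum_mul_sq_le_sq_mul_sq _ _ _
  have h3 : ∑ k, ‖c k‖ * t k ≤ Real.sqrt (∑ k, t k ^ 2) * ‖∑ k, c k • v k‖ := by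
    have hs : 0 ≤ ∑ k, ‖c k‖ * t k := Finset.sum_nonneg fun k _ => mul_nonneg (norm_nonneg _) (ht0 k)
    have hrhs : 0 ≤ Real.sqrt (∑ k, t k ^ 2) * ‖∑ k, c k • v k‖ := by positivity
    rw [← Real.sqrt_sq hs, ← Real.sqrt_sq hrhs]
    apply Real.sqrt_le_sqrt
    rw [mul_pow, Real.sq_sqrt (Finset.sum_nonneg fun k _ => sq_nonneg _), hnorm]
    linarith [h2]
  exact le_trans h1 h3

/-- **Transfer to the other side** (best approximation by an explicit multiple). `P` (= `P_W`) and `PV` self-adjoint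
idempotents, `v ∈ ran PV` with `‖v − P v‖ ≤ θ₁ ‖v‖`; then `w := P v` satisfies `‖w − PV w‖ ≤ θ₁ ‖w‖`. [folklore] -/
theorem norm_sub_proj_le_of_fixed (P PV : E →L[𝕜] E)
    (hsa : ∀ x y : E, ⟪P x, y⟫_𝕜 = ⟪x, P y⟫_𝕜) (hid : ∀ x : E, P (P x) = P x)
    (hVsa : ∀ x y : E, ⟪PV x, y⟫_𝕜 = ⟪x, PV y⟫_𝕜) (hVid : ∀ x : E, PV (PV x) = PV x)
    {θ₁ : ℝ} (hθ : 0 ≤ θ₁) (v : E) (hvV : PV v = v) (hv : ‖v - P v‖ ≤ θ₁ * ‖v‖) :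
    ‖P v - PV (P v)‖ ≤ θ₁ * ‖P v‖ := by
  -- best approximation: ‖w − PV w‖ ≤ ‖w − y‖ for every y ∈ ran PV
  have best : ∀ (w y : E), PV y = y → ‖w - PV w‖ ≤ ‖w - y‖ := by
    intro w y hy
    have horth : re ⟪w - PV w, PV w - y⟫_𝕜 = 0 := by
      have : PV w - y = PV (w - y) := by rw [map_sub, hy]
      rw [this, ← hVsa, map_sub, hVid, sub_self, inner_zero_left, map_zero]
    have hsq : ‖w - y‖ ^ 2 = ‖w - PV w‖ ^ 2 + ‖PV w - y‖ ^ 2 := by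
      have h := norm_add_sq (𝕜 := 𝕜) (w - PV w) (PV w - y)
      have heq : w - PV w + (PV w - y) = w - y := by abel
      rw [heq] at h; rw [h, horth]; ring
    nlinarith [norm_nonneg (w - y), norm_nonneg (w - PV w), norm_nonneg (PV w - y)]
  by_cases hv0 : v = 0
  · subst hv0; simp
  have hvpos : 0 < ‖v‖ := norm_pos_iff.mpr hv0
  -- explicit candidate y = a • v with a = ‖P v‖² / ‖v‖²
  set a : ℝ := ‖P v‖ ^ 2 / ‖v‖ ^ 2 with ha
  have hy : PV ((a : 𝕜) • v) = (a : 𝕜) • v := by rw [map_smul, hvV]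
  have h1 := best (P v) ((a : 𝕜) • v) hy
  -- ‖P v − a v‖² = ‖P v‖² − 2 a ‖P v‖² + a² ‖v‖² = ‖P v‖² ‖v − P v‖² / ‖v‖²
  have hre : re ⟪P v, (a : 𝕜) • v⟫_𝕜 = a * ‖P v‖ ^ 2 := by
    rw [inner_smul_right, re_ofReal_mul, re_inner_proj_self P hsa hid v]
  have hnsq : ‖P v - (a : 𝕜) • v‖ ^ 2 = ‖P v‖ ^ 2 * (‖v - P v‖ ^ 2 / ‖v‖ ^ 2) := by
    rw [norm_sub_sq (𝕜 := 𝕜), hre, norm_smul, RCLike.norm_ofReal, mul_pow, sq_abs, ha]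
    have hpy := norm_sq_eq_proj_add_coproj P hsa hid v
    field_simp
    nlinarith [hpy]
  have hbound : ‖P v - (a : 𝕜) • v‖ ^ 2 ≤ (θ₁ * ‖P v‖) ^ 2 := by
    rw [hnsq, mul_pow]
    have h2 : ‖v - P v‖ ^ 2 / ‖v‖ ^ 2 ≤ θ₁ ^ 2 := by
      rw [div_le_iff₀ (by positivity)]
      have := hv
      nlinarith [norm_nonneg (v - P v), mul_nonneg hθ (norm_nonneg v)]
    nlinarith [h2, sq_nonneg ‖P v‖]
  have h3 : ‖P v - (a : 𝕜) • v‖ ≤ θ₁ * ‖P v‖ := by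
    have h0 : 0 ≤ θ₁ * ‖P v‖ := mul_nonneg hθ (norm_nonneg _)
    nlinarith [hbound, norm_nonneg (P v - (a : 𝕜) • v), h0]
  exact le_trans h1 h3

/-- **From `ran P_W` back to all of `E`.** If `‖w − PV w‖ ≤ θ₂ ‖w‖` for every `w ∈ ran P` then
`‖P (u − PV u)‖ ≤ θ₂ ‖u‖` for every `u` (i.e. `‖P (1 − PV)‖ = ‖(1 − PV) P‖ ≤ θ₂`, proved without adjoints). [folklore] -/
theorem norm_projW_comp_coproj_le (P PV : E →L[𝕜] E)
    (hsa : ∀ x y : E, ⟪P x, y⟫_𝕜 = ⟪x, P y⟫_𝕜) (hid : ∀ x : E, P (P x) = P x)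
    (hVsa : ∀ x y : E, ⟪PV x, y⟫_𝕜 = ⟪x, PV y⟫_𝕜) (hVid : ∀ x : E, PV (PV x) = PV x)
    {θ₂ : ℝ} (hθ : 0 ≤ θ₂) (hW : ∀ w : E, P w = w → ‖w - PV w‖ ≤ θ₂ * ‖w‖) (u : E) :
    ‖P (u - PV u)‖ ≤ θ₂ * ‖u‖ := by
  set w : E := P (u - PV u) with hw
  have hPw : P w = w := by rw [hw, hid]
  have horth : ⟪u - PV u, PV w⟫_𝕜 = 0 := by
    rw [← hVsa, map_sub, hVid, sub_self, inner_zero_left]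
  have hsq : ‖w‖ ^ 2 = re ⟪u - PV u, w - PV w⟫_𝕜 := by
    have h1 : (‖w‖ ^ 2 : ℝ) = re ⟪w, w⟫_𝕜 := by rw [inner_self_eq_norm_sq_to_K]; norm_cast
    rw [h1]
    conv_lhs => rw [hw]
    rw [hsa, ← hw, hPw, inner_sub_right, horth, sub_zero]
  have hcs : re ⟪u - PV u, w - PV w⟫_𝕜 ≤ ‖u - PV u‖ * ‖w - PV w‖ := re_inner_le_norm _ _
  have hu : ‖u - PV u‖ ≤ ‖u‖ := (norm_proj_le PV hVsa hVid u).2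
  have hww : ‖w - PV w‖ ≤ θ₂ * ‖w‖ := hW w hPw
  have hmain : ‖w‖ ^ 2 ≤ ‖u‖ * (θ₂ * ‖w‖) := by
    calc ‖w‖ ^ 2 = re ⟪u - PV u, w - PV w⟫_𝕜 := hsq
      _ ≤ ‖u - PV u‖ * ‖w - PV w‖ := hcs
      _ ≤ ‖u‖ * (θ₂ * ‖w‖) := mul_le_mul hu hww (norm_nonneg _) (norm_nonneg _)
  by_cases h0 : ‖w‖ = 0
  · rw [h0]; positivity
  · have hpos : 0 < ‖w‖ := lt_of_le_of_ne (norm_nonneg _) (Ne.symm h0)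
    have : ‖w‖ * ‖w‖ ≤ (θ₂ * ‖u‖) * ‖w‖ := by nlinarith [hmain]
    exact le_of_mul_le_mul_right this hpos

/-- **The consumable inequality** `‖P_W u‖ ≤ ‖P_V u‖ + θ₂ ‖u‖` (input `htri`/`hnear` of
`SpectralCutCoercivity.coercive_of_cut_of_proj_near`, in its one-sided form). [folklore] -/
theorem norm_projW_le_projV_add (P PV : E →L[𝕜] E)
    (hsa : ∀ x y : E, ⟪P x, y⟫_𝕜 = ⟪x, P y⟫_𝕜) (hid : ∀ x : E, P (P x) = P x)
    (hVsa : ∀ x y : E, ⟪PV x, y⟫_𝕜 = ⟪x, PV y⟫_𝕜) (hVid : ∀ x : E, PV (PV x) = PV x)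
    {θ₂ : ℝ} (hθ : 0 ≤ θ₂) (hW : ∀ w : E, P w = w → ‖w - PV w‖ ≤ θ₂ * ‖w‖) (u : E) :
    ‖P u‖ ≤ ‖PV u‖ + θ₂ * ‖u‖ := by
  have h1 : P u = P (PV u) + P (u - PV u) := by rw [map_sub]; abel
  rw [h1]
  refine le_trans (norm_add_le _ _) (add_le_add ?_ ?_)
  · exact (norm_proj_le P hsa hid (PV u)).1
  · exact norm_projW_comp_coproj_le P PV hsa hid hVsa hVid hθ hW u

/-- **Injectivity of `P_W` on `V` from `θ₁ < 1`.** [folklore] -/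
theorem proj_injective_of_lt_one (P : E →L[𝕜] E) {θ₁ : ℝ} (hθ : θ₁ < 1)
    (V : Submodule 𝕜 E) (hV : ∀ v ∈ V, ‖v - P v‖ ≤ θ₁ * ‖v‖) :
    ∀ v ∈ V, P v = 0 → v = 0 := by
  intro v hv hPv
  have h := hV v hv
  rw [hPv, sub_zero] at h
  have : (1 - θ₁) * ‖v‖ ≤ 0 := by linarith
  have hn : ‖v‖ ≤ 0 := by
    by_contra hcon
    have hcon' : 0 < ‖v‖ := lt_of_not_ge hcon
    have : 0 < (1 - θ₁) * ‖v‖ := mul_pos (by linarith) hcon'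
    linarith
  exact norm_le_zero_iff.mp hn

/-- **Equal dimensions ⇒ `P_W` maps `V` ONTO `W`** (injective + `finrank V = finrank W`). This is where the EXACT
certified eigenvalue count (`dim W = n = dim V`) enters. [folklore] (rank–nullity) -/
theorem proj_surjOn_of_finrank_eq (P : E →L[𝕜] E) (V W : Submodule 𝕜 E)
    [FiniteDimensional 𝕜 V] [FiniteDimensional 𝕜 W]
    (hdim : Module.finrank 𝕜 V = Module.finrank 𝕜 W)
    (hPW : ∀ x : E, P x ∈ W) (hinj : ∀ v ∈ V, P v = 0 → v = 0) :
    ∀ w ∈ W, ∃ v ∈ V, P v = w := by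
  let f : V →ₗ[𝕜] W := LinearMap.codRestrict W ((P : E →ₗ[𝕜] E).comp V.subtype) (fun v => hPW v)
  have hf_inj : Function.Injective f := by
    intro a b hab
    have h1 : P (a : E) = P (b : E) := by
      have := congrArg (fun z : W => (z : E)) hab
      simpa [f] using this
    have h2 : P ((a : E) - (b : E)) = 0 := by rw [map_sub, h1, sub_self]
    have h3 := hinj _ (V.sub_mem a.2 b.2) h2
    ext; exact sub_eq_zero.mp h3
  have hf_surj : Function.Surjective f :=
    (LinearMap.injective_iff_surjective_of_finrank_eq_finrank hdim).mp hf_inj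
  intro w hw
  obtain ⟨v, hv⟩ := hf_surj ⟨w, hw⟩
  refine ⟨v, v.2, ?_⟩
  have := congrArg (fun z : W => (z : E)) hv
  simpa [f] using this

/-- **Assembly: from certified Ritz data to `‖P_W u‖ ≤ ‖P_V u‖ + θ₁ ‖u‖`.** Inputs: `P` (= `P_W`) a self-adjoint
idempotent commuting with the bounded self-adjoint `B` and with `Re ⟪B ξ, ξ⟫ ≤ bhi ‖ξ‖²` on `ran (1 − P)` (spectral
theorem, paper-level); `PV` the projection onto the span of an orthonormal Ritz family `v` with residuals
`‖B v_k − m_k v_k‖ ≤ ρ_k`, `m_k > bhi`; `θ₁ = √(∑ (ρ_k/(m_k − bhi))²)`; and `P` maps `ran PV` onto `ran P`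
(`proj_surjOn_of_finrank_eq`). [cite: DavisKahan1970, §2] [cite: Kato1949, Lemma 2] -/
theorem norm_projW_le_projV_add_of_ritz {ι : Type*} [Fintype ι] (B P PV : E →L[𝕜] E)
    (hPB : ∀ x : E, P (B x) = B (P x))
    (hsa : ∀ x y : E, ⟪P x, y⟫_𝕜 = ⟪x, P y⟫_𝕜) (hid : ∀ x : E, P (P x) = P x)
    (hVsa : ∀ x y : E, ⟪PV x, y⟫_𝕜 = ⟪x, PV y⟫_𝕜) (hVid : ∀ x : E, PV (PV x) = PV x)
    (v : ι → E) (hv : Orthonormal 𝕜 v)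
    (hVspan : ∀ x : E, PV x = x → ∃ c : ι → 𝕜, x = ∑ k, c k • v k)
    {bhi : ℝ} (m ρ : ι → ℝ)
    (hhi : ∀ x : E, re ⟪B (x - P x), x - P x⟫_𝕜 ≤ bhi * ‖x - P x‖ ^ 2)
    (hgap : ∀ k, bhi < m k) (hres : ∀ k, ‖B (v k) - (m k : 𝕜) • v k‖ ≤ ρ k)
    (hsurj : ∀ w : E, P w = w → ∃ x : E, PV x = x ∧ P x = w) (u : E) :
    ‖P u‖ ≤ ‖PV u‖ + Real.sqrt (∑ k, (ρ k / (m k - bhi)) ^ 2) * ‖u‖ := by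
  -- the complementary projection Q = 1 − P
  set Q : E →L[𝕜] E := 1 - P with hQ
  have hQapp : ∀ x : E, Q x = x - P x := fun x => by simp [hQ]
  have hQB : ∀ x : E, Q (B x) = B (Q x) := fun x => by rw [hQapp, hQapp, map_sub, hPB]
  have hQsa : ∀ x y : E, ⟪Q x, y⟫_𝕜 = ⟪x, Q y⟫_𝕜 := fun x y => by
    rw [hQapp, hQapp, inner_sub_left, inner_sub_right, hsa]
  have hQid : ∀ x : E, Q (Q x) = Q x := fun x => by
    rw [hQapp, hQapp, map_sub, hid]; abel
  have hQhi : ∀ x : E, re ⟪B (Q x), Q x⟫_𝕜 ≤ bhi * ‖Q x‖ ^ 2 := fun x => by rw [hQapp]; exact hhi x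
  -- per Ritz vector
  have hk : ∀ k, ‖Q (v k)‖ ≤ ρ k / (m k - bhi) := fun k =>
    norm_proj_le_residual_div_gap B Q hQB hQsa hQid hQhi (hgap k) (v k) (hres k)
  set θ₁ : ℝ := Real.sqrt (∑ k, (ρ k / (m k - bhi)) ^ 2) with hθ₁
  have hθ0 : 0 ≤ θ₁ := Real.sqrt_nonneg _
  -- on V
  have hV : ∀ x : E, PV x = x → ‖x - P x‖ ≤ θ₁ * ‖x‖ := by
    intro x hx
    obtain ⟨c, rfl⟩ := hVspan x hx
    rw [← hQapp]
    exact norm_proj_sum_le_sqrt Q v hv _ hk c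
  -- on W
  have hW : ∀ w : E, P w = w → ‖w - PV w‖ ≤ θ₁ * ‖w‖ := by
    intro w hw
    obtain ⟨x, hx, rfl⟩ := hsurj w hw
    exact norm_sub_proj_le_of_fixed P PV hsa hid hVsa hVid hθ0 x hx (hV x hx)
  exact norm_projW_le_projV_add P PV hsa hid hVsa hVid hθ0 hW u

/-- **Coercivity of the shifted form from the one-sided proximity** — the variant of
`coercive_of_cut_of_proj_near` whose proximity hypothesis is exactly the output of `norm_projW_le_projV_add_of_ritz`:
from `β ‖u‖² − (β − amin) ‖PW u‖² ≤ a u`, `amin ≤ β`, `‖PW u‖ ≤ ‖PV u‖ + θ ‖u‖` and `2 (β − amin) ≤ s`: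
`(β − 2 (β − amin) θ²) ‖u‖² ≤ a u + s ‖PV u‖²`. [folklore] -/
theorem coercive_of_cut_of_proj_le (p : Submodule 𝕜 E) (a : E → ℝ) (PW PV : E →L[𝕜] E)
    (amin β θ s : ℝ) (hβ : amin ≤ β) (hθ : 0 ≤ θ) (hs : 2 * (β - amin) ≤ s)
    (hcut : ∀ u ∈ p, β * ‖u‖ ^ 2 - (β - amin) * ‖PW u‖ ^ 2 ≤ a u)
    (htri : ∀ u : E, ‖PW u‖ ≤ ‖PV u‖ + θ * ‖u‖) :
    ∀ u ∈ p, (β - 2 * (β - amin) * θ ^ 2) * ‖u‖ ^ 2 ≤ a u + s * ‖PV u‖ ^ 2 := by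
  intro u hu
  have hc := hcut u hu
  have ht := htri u
  have hPV : 0 ≤ ‖PV u‖ := norm_nonneg _
  have hPW : 0 ≤ ‖PW u‖ := norm_nonneg _
  have hsq : ‖PW u‖ ^ 2 ≤ 2 * ‖PV u‖ ^ 2 + 2 * (θ * ‖u‖) ^ 2 := by
    have h0 : 0 ≤ ‖PV u‖ + θ * ‖u‖ := by positivity
    have h1 : ‖PW u‖ ^ 2 ≤ (‖PV u‖ + θ * ‖u‖) ^ 2 := pow_le_pow_left₀ hPW ht 2
    nlinarith [h1, sq_nonneg (‖PV u‖ - θ * ‖u‖)]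
  have hβa : 0 ≤ β - amin := by linarith
  have h4 : (β - amin) * ‖PW u‖ ^ 2 ≤ (β - amin) * (2 * ‖PV u‖ ^ 2 + 2 * (θ * ‖u‖) ^ 2) :=
    mul_le_mul_of_nonneg_left hsq hβa
  have h5 : s * ‖PV u‖ ^ 2 ≥ 2 * (β - amin) * ‖PV u‖ ^ 2 := by nlinarith [hs, sq_nonneg ‖PV u‖]
  nlinarith [hc, h4, h5, sq_nonneg (θ * ‖u‖)]

end Literature.Analysis.OperatorTheory

end
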